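import Summits.QuantumFields.YangMills.Theorems.BalabanUVNodesN15KingModelCurvatureDecay
import Summits.QuantumFields.YangMills.Theorems.BalabanUVNodesN15KingModelCurvatureStability
import Summits.QuantumFields.YangMills.Theorems.BalabanUVNodesN15KingModelCurvatureBoundedBelow
import HarnessLib

/-!
# BalabanUVNodes ∕ N15 — THE KING-MODEL RUNG (PART Ϳ-k): CURVATURE-INDUCED DECAY, NON-ABELIAN — Ϳ-g's covariant Combes–Thomas estimate fed with the coercivity constants of
# Ϳ-e (Kogut–Susskind), Ϳ-j (the open balls of non-abelian fields around it), Ϳ-f (holonomy gap; inhomogeneous `U(1)` flux floor): the MASSLESS covariant covariance decays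
# exponentially, with volume-independent constants, on OPEN SETS of NON-ABELIAN link fields
# (Track A, DAG node N15 = NE2; FAN-OUT v1.1 §N15 s3 «KING-MODEL RUNG … + what the curved case adds»; count-neutral)

HONEST FRAMING.  Count-neutral (cell `pub-ymgap`, seat `pub-ymgap-dag-n15-e` g46; `--supports stmt-QuantumFields-27247 --as helper` = K3ᴬ, KEY MAP v3).  King's fine covariance layer
`−cΔ_U+m²` (Ͱ-a `covLapF`) on ONE finite torus; corollaries BY NAME of Ϳ-g with Ϳ-e∕Ϳ-f∕Ϳ-j; NOT Bałaban's `G_k(U)`; NOT [Balaban1985BackgroundPropagators] (3.42); NOT a node discharge (N15 of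
record untouched); nothing continuum ∕ ℝ⁴ ∕ OS ∕ Clay.

THE RESULTS (`d(x,y)` = `tdistT`; rates `δ > 0` depend on `d` and the stated gap parameters only — never on the volume, never on `c`):
* §1 `ks_gap_pos` (`2(d+1) − 2√(d+1) > 0` for `d ≥ 1`), ★★★ **`norm_covLapF_ks_massless_inv_entry_le`** — at the Kogut–Susskind field (all `K` even, `d ≥ 1`, `c > 0`, `m² = 0`, any fibre):
  `‖G_U((x,i),(y,j))‖ ≤ (2∕((2(d+1)−2√(d+1))c))·e^{−δ·d(x,y)}`;
* §2 ★★★★ **`norm_covLapF_near_ks_massless_inv_entry_le`** — for EVERY unitary `U(n)`-valued field `V` with `‖V(b) − η_μ(x)·1‖ ≤ ε` bondwise, `ε < 1∕2`: `‖G_V((x,i),(y,j))‖ ≤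
  (2∕((d+1)c·λ(4ε−1)))·e^{−δ·d(x,y)}` with ONE rate `δ = δ(d, ε)` for the whole ball — uniform exponential decay of the massless covariance on an open set of non-abelian, non-constant fields;
* §3 ★★★ **`norm_covLapF_inv_entry_le_exp_of_holonomy_gap`** — any fibre, `m² + 2c·λ(1−s²∕2) > 0`, holonomies `s`-far from `1` (Ϳ-f): decay at rate `δ(d, c, κ)`;
  ★★★ **`norm_covLapF_inv_entry_le_exp_of_plaq_angle`** — `U(1)`, inhomogeneous flux floor `θ₀ ≤ |arg P(x)|` (Ϳ-f): decay with `κ = m² + 2c(2−2cos(θ₀∕4))`.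
WHAT THE CURVED CASE ADDS (as theorems): exponential LOCALISATION of King's massless covariance is a robust consequence of curvature bounded below — abelian or not, constant or not — on
every finite torus, uniformly in its size.
PRIOR TREE ART (by name, not restated): Ϳ-g (`norm_covLapF_inv_entry_le_exp_half`, `exists_rate_of_coercive`), Ϳ-e (`ksLink`, `ksLink_mem_unitaryGroup`, `re_quadForm_covLapF_ks_ge`), Ϳ-j
(`re_quadForm_covLapF_ge_near_ks`), Ϳ-f (`re_quadForm_covLapF_ge_of_holonomy_gap`, `re_quadForm_covLapF_ge_of_plaq_angle`), Ϳ-a (`plaqGap`), Ϳ-c (`plaqGap_pos_of_lt_one`), Ͱ-a (`covLapF`), `King1986.Torus.tdistT`.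
Dedup (rg at filing): basename 0 files; needles `ks_gap_pos|norm_covLapF_ks_massless_inv_entry_le|norm_covLapF_near_ks_massless_inv_entry_le|norm_covLapF_inv_entry_le_exp_of_holonomy_gap|norm_covLapF_inv_entry_le_exp_of_plaq_angle` 0
tree files.  Locators: [DodziukMathai2006] §1 Cor 1.3; [King1986] (4.4) p.670, (4.38) p.674 (shape); [Balaban1985BackgroundPropagators] (3.39) p.397 (shape).  0 `sorry`, 0 `def`.
-/

noncomputable section
open scoped BigOperators ComplexConjugate ComplexOrder InnerProductSpace Matrix.Norms.L2Operator
open Finset Matrix WithLp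

namespace Summit.QuantumFields.YangMills.BalabanUVNodes.N15KingModelRung.Curvature

open Literature.MathematicalPhysics.QuantumFieldTheory.Balaban1983to89.B5Prop11Plancherel (Tor unitVec)
open Literature.MathematicalPhysics.QuantumFieldTheory.King1986.Torus (tdistT)
open Summit.QuantumFields.YangMills.BalabanUVNodes.N15KingModelRung.Covariant (covLapF fib)
open Summit.QuantumFields.YangMills.BalabanUVNodes.N15KingModelRung.Cover (kingPlaq)

variable {d : ℕ} (K : Fin (d + 1) → ℕ) [hK : ∀ μ, NeZero (K μ)]
variable {𝕜 : Type*} [RCLike 𝕜] {n : Type*} [Fintype n] [DecidableEq n] {c : ℝ}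

/-! ## §1 The Kogut–Susskind field -/

omit hK [Fintype n] [DecidableEq n] in
/-- `2(d+1) − 2√(d+1) > 0` for `d ≥ 1`. [folklore] -/
theorem ks_gap_pos (hd : 0 < d) : 0 < 2 * ((d : ℝ) + 1) - 2 * Real.sqrt ((d : ℝ) + 1) := by
  have hd' : (1 : ℝ) ≤ d := by exact_mod_cast hd
  have hD : (1 : ℝ) < (d : ℝ) + 1 := by linarith
  have hs : Real.sqrt ((d : ℝ) + 1) < (d : ℝ) + 1 := by
    have h1 : Real.sqrt ((d : ℝ) + 1) * Real.sqrt ((d : ℝ) + 1) = (d : ℝ) + 1 := Real.mul_self_sqrt (by linarith)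
    have h2 : 1 < Real.sqrt ((d : ℝ) + 1) := by have := Real.sqrt_lt_sqrt zero_le_one hD; rwa [Real.sqrt_one] at this
    nlinarith
  linarith

/-- ★★★ **THE MASSLESS COVARIANCE AT THE KOGUT–SUSSKIND FIELD DECAYS EXPONENTIALLY** (all `K` even, `d ≥ 1`, `c > 0`, any fibre): there is `δ = δ(d) > 0` with
`‖(−cΔ_U)⁻¹((x,i),(y,j))‖ ≤ (2∕((2(d+1)−2√(d+1))c))·e^{−δ·d(x,y)}` for all sites and fibre indices. [cite: DodziukMathai2006, Cor 1.3 §1; King1986, (4.38) p.674] -/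
theorem norm_covLapF_ks_massless_inv_entry_le (hd : 0 < d) (hc : 0 < c) (hK2 : ∀ μ, Even (K μ)) :
    ∃ δ : ℝ, 0 < δ ∧ ∀ (x y : Tor K) (i j : n),
      ‖(covLapF K c 0 (ksLink K (n := n) (𝕜 := 𝕜)))⁻¹ (x, i) (y, j)‖ ≤ 2 / ((2 * ((d : ℝ) + 1) - 2 * Real.sqrt ((d : ℝ) + 1)) * c) * Real.exp (-(δ * tdistT K x y)) := by
  set g : ℝ := 2 * ((d : ℝ) + 1) - 2 * Real.sqrt ((d : ℝ) + 1) with hg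
  have hg0 : 0 < g := ks_gap_pos hd
  obtain ⟨δ, hδ0, _, hδ⟩ := exists_rate_of_coercive (d := d) (c := 1) zero_le_one (κ := g) hg0
  refine ⟨δ, hδ0, fun x y i j => ?_⟩
  have hκ : 0 < g * c := mul_pos hg0 hc
  have hcoer : ∀ v : Tor K × n → 𝕜, g * c * ∑ x, ‖fib K v x‖ ^ 2 ≤ RCLike.re (star v ⬝ᵥ (covLapF K c 0 (ksLink K) *ᵥ v)) := fun v => by
    have h := re_quadForm_covLapF_ks_ge K hc.le 0 hK2 v
    rwa [zero_add, ← hg] at h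
  have hρ : 2 * ((d : ℝ) + 1) * c * (Real.cosh δ - 1) ≤ g * c / 2 := by
    have : 2 * ((d : ℝ) + 1) * (Real.cosh δ - 1) ≤ g / 2 := by linarith
    nlinarith [hc.le]
  exact norm_covLapF_inv_entry_le_exp_half K hc.le 0 (ksLink_mem_unitaryGroup K) hκ hcoer hδ0.le hρ x y i j

/-! ## §2 The open ball of non-abelian fields around it -/

/-- ★★★★ **UNIFORM DECAY ON AN OPEN BALL OF NON-ABELIAN FIELDS**: for `ε < 1∕2`, all `K` even, `d ≥ 1`, `c > 0`, there is ONE rate `δ = δ(d, ε) > 0` such that EVERY unitary `U(n)`-valued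
field `V` with `‖V(b) − η_μ(x)·1‖ ≤ ε` on every bond satisfies `‖(−cΔ_V)⁻¹((x,i),(y,j))‖ ≤ (2∕((d+1)c·λ(4ε−1)))·e^{−δ·d(x,y)}` — massless, volume-independent.
[cite: DodziukMathai2006, Cor 1.3 §1; King1986, (4.38) p.674; Balaban1985BackgroundPropagators, (3.39) p.397] -/
theorem norm_covLapF_near_ks_massless_inv_entry_le (hd : 0 < d) (hc : 0 < c) (hK2 : ∀ μ, Even (K μ)) {ε : ℝ} (hε : ε < 1 / 2) :
    ∃ δ : ℝ, 0 < δ ∧ ∀ {V : Tor K × Fin (d + 1) → Matrix n n 𝕜}, (∀ b, V b ∈ Matrix.unitaryGroup n 𝕜) → (∀ b, ‖V b - ksLink K b‖ ≤ ε) →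
      ∀ (x y : Tor K) (i j : n), ‖(covLapF K c 0 V)⁻¹ (x, i) (y, j)‖ ≤ 2 / (((d : ℝ) + 1) * c * plaqGap (4 * ε - 1)) * Real.exp (-(δ * tdistT K x y)) := by
  set g : ℝ := ((d : ℝ) + 1) * plaqGap (4 * ε - 1) with hg
  have hlam : 0 < plaqGap (4 * ε - 1) := plaqGap_pos_of_lt_one (by linarith)
  have hg0 : 0 < g := by positivity
  obtain ⟨δ, hδ0, _, hδ⟩ := exists_rate_of_coercive (d := d) (c := 1) zero_le_one (κ := g) hg0
  refine ⟨δ, hδ0, fun hV hεV x y i j => ?_⟩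
  have hκ : 0 < ((d : ℝ) + 1) * c * plaqGap (4 * ε - 1) := by positivity
  have hcoer : ∀ v : Tor K × n → 𝕜, ((d : ℝ) + 1) * c * plaqGap (4 * ε - 1) * ∑ x, ‖fib K v x‖ ^ 2 ≤ RCLike.re (star v ⬝ᵥ (covLapF K c 0 _ *ᵥ v)) := fun v => by
    have h := re_quadForm_covLapF_ge_near_ks K hd hc.le 0 hK2 hV hεV v
    rwa [zero_add] at h
  have hρ : 2 * ((d : ℝ) + 1) * c * (Real.cosh δ - 1) ≤ ((d : ℝ) + 1) * c * plaqGap (4 * ε - 1) / 2 := by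
    have : 2 * ((d : ℝ) + 1) * (Real.cosh δ - 1) ≤ g / 2 := by linarith
    rw [hg] at this
    nlinarith [hc.le]
  exact norm_covLapF_inv_entry_le_exp_half K hc.le 0 hV hκ hcoer hδ0.le hρ x y i j

/-! ## §3 Holonomy gap (non-abelian) and inhomogeneous `U(1)` flux floor -/

/-- ★★★ **DECAY FROM A HOLONOMY GAP** (any fibre, `ν₀ ≠ ν₁`, `c ≥ 0`, `s ≥ 0`): if the `(ν₀,ν₁)`-holonomies are `s`-far from `1` on every vector and `κ := m² + 2c·λ(1−s²∕2) > 0`, then for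
every `δ ≥ 0` with `2(d+1)c(cosh δ − 1) ≤ κ∕2`: `‖(−cΔ_U+m²)⁻¹((x,i),(y,j))‖ ≤ (2∕κ)e^{−δ·d(x,y)}`. [cite: DodziukMathai2006, Cor 1.3 §1; King1986, (4.38) p.674] -/
theorem norm_covLapF_inv_entry_le_exp_of_holonomy_gap (hc : 0 ≤ c) (m2 : ℝ) {U : Tor K × Fin (d + 1) → Matrix n n 𝕜} (hU : ∀ b, U b ∈ Matrix.unitaryGroup n 𝕜) {ν₀ ν₁ : Fin (d + 1)}
    (hν : ν₀ ≠ ν₁) {s : ℝ} (hs0 : 0 ≤ s) (hs : ∀ x, ∀ u : EuclideanSpace 𝕜 n, s * ‖u‖ ≤ ‖Matrix.toEuclideanLin (kingPlaq K U x ν₀ ν₁) u - u‖)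
    (hκ : 0 < m2 + 2 * c * plaqGap (1 - s ^ 2 / 2)) {δ : ℝ} (hδ : 0 ≤ δ) (hρ : 2 * ((d : ℝ) + 1) * c * (Real.cosh δ - 1) ≤ (m2 + 2 * c * plaqGap (1 - s ^ 2 / 2)) / 2) (x y : Tor K) (i j : n) :
    ‖(covLapF K c m2 U)⁻¹ (x, i) (y, j)‖ ≤ 2 / (m2 + 2 * c * plaqGap (1 - s ^ 2 / 2)) * Real.exp (-(δ * tdistT K x y)) :=
  norm_covLapF_inv_entry_le_exp_half K hc m2 hU hκ (re_quadForm_covLapF_ge_of_holonomy_gap K hc m2 hU hν hs0 hs) hδ hρ x y i j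

/-- ★★★ **DECAY FROM AN INHOMOGENEOUS FLUX FLOOR** (`U(1)`, `ν₀ ≠ ν₁`, `c ≥ 0`, `0 ≤ θ₀ ≤ π`, `θ₀ ≤ |arg P(x)|` everywhere): with `κ := m² + 2c(2−2cos(θ₀∕4)) > 0` and any admissible `δ`:
`|(−cΔ_U+m²)⁻¹(x,y)| ≤ (2∕κ)e^{−δ·d(x,y)}`. [cite: DodziukMathai2006, Cor 1.3 §1; King1986, (4.38) p.674] -/
theorem norm_covLapF_inv_entry_le_exp_of_plaq_angle (hc : 0 ≤ c) (m2 : ℝ) {U : Tor K × Fin (d + 1) → Matrix Unit Unit ℂ} (hU : ∀ b, U b ∈ Matrix.unitaryGroup Unit ℂ) {ν₀ ν₁ : Fin (d + 1)}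
    (hν : ν₀ ≠ ν₁) {θ₀ : ℝ} (h0 : 0 ≤ θ₀) (hπ : θ₀ ≤ Real.pi) (hθ : ∀ x, θ₀ ≤ |Complex.arg (kingPlaq K U x ν₀ ν₁ () ())|)
    (hκ : 0 < m2 + 2 * c * (2 - 2 * Real.cos (θ₀ / 4))) {δ : ℝ} (hδ : 0 ≤ δ) (hρ : 2 * ((d : ℝ) + 1) * c * (Real.cosh δ - 1) ≤ (m2 + 2 * c * (2 - 2 * Real.cos (θ₀ / 4))) / 2) (x y : Tor K) :
    ‖(covLapF K c m2 U)⁻¹ (x, ()) (y, ())‖ ≤ 2 / (m2 + 2 * c * (2 - 2 * Real.cos (θ₀ / 4))) * Real.exp (-(δ * tdistT K x y)) :=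
  norm_covLapF_inv_entry_le_exp_half K hc m2 hU hκ (re_quadForm_covLapF_ge_of_plaq_angle K hc m2 hU hν h0 hπ hθ) hδ hρ x y () ()

end Summit.QuantumFields.YangMills.BalabanUVNodes.N15KingModelRung.Curvature

end
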